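import Literature.MathematicalPhysics.QuantumLattice.LiebWuFillingIdentity
import Literature.MathematicalPhysics.QuantumLattice.LiebWuRho0Bounds
import HarnessLib

/-!
# Positivity of the source of `σ_R - σ_P` (towards Lieb–Wu 2003, Lemmas 3–4 and Theorem 3 at `B = ∞`)

Family `hubbard`. Lieb–Wu, Physica A 321 (2003) 1 = arXiv:cond-mat/0207529, §5: LEMMA 3 (`ρ > 0`),
LEMMA 4 (`σ` increases with `Q`), THEOREM 3 (`N/N_a` increases with `Q`) rest, in print, on
differentiation in `a = sin Q` and on LEMMA 5 (§6: `ρ₀ > 0`, the `Q = π` closed form — in the tree as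
`liebWuRho0_pos`). This file proves the two DERIVATIVE-FREE ingredients from which
`LiebWuFillingMonotone` obtains those statements for the Neumann-series solution
`σ_Q = liebWuSigmaAt U Q` (`U > 0`): for cutoffs `0 < P < R ≤ π`, subtracting the fixed-point equations
(S) `σ = ξ + Ŵσ` at the two cutoffs gives `δ := σ_R - σ_P = s + Ŵ_P δ` with SOURCE
`s = (ξ_R - ξ_P) + (Ŵ_R - Ŵ_P)σ_R`, and

* `liebWu_source_pos`: **`s > 0`** whenever `0 ≤ h := σ_R ≤ σ₀`: `ξ_R - ξ_P = ¼π⁻¹∫_{P<|k|≤R} r(x - sin k) dk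
  > 0`; `(Ŵ_R - Ŵ_P)h = ½∫ (1_{(-a_R,a_R]} - 1_{(-a_P,a_P]})(h∗K) r(x - ·)` is `≥ 0` if `a_P ≤ a_R`
  ("`Â` has a kernel that increases with `a`"), and if `a_R < a_P` (so `R > π/2`) the substitution
  `y = sin k` on `k₀ = max(P, π/2) ≤ |k| ≤ R` bounds `s` below by
  `∫_{k₀≤|k|≤R} ½ r(x - sin k)(1/2π + cos k (h∗K)(sin k)) dk ≥ ∫ ½ r(x - sin k) ρ₀(k) dk > 0`
  (`h∗K ≤ σ₀∗K`, `cos k ≤ 0`, and `ρ₀(k) = 1/2π + cos k (σ₀∗K)(sin k) > 0` = Lemma 5: the edge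
  inequality `liebWu_edge_pos`);
* `nonneg_of_sub_liebWuW_nonneg`: **positivity** — if `δ` is continuous, integrable and `δ - Ŵ_Q δ ≥ 0`
  then `δ ≥ 0` (`δ⁻ ≤ Ŵ_Q δ⁻` since `Ŵ_Q` has a positive kernel, and `∫Ŵ_Q δ⁻ ≤ ½∫δ⁻`, the
  contraction bound of the proof of Theorem 1, forces `δ⁻ = 0`).

No definition, no named fact.

## References

* E. H. Lieb, F. Y. Wu, Physica A 321 (2003) 1–27 = arXiv:cond-mat/0207529, §5, proofs of Lemmas 2–4 and
  of Theorem 1; §6, Lemma 5 (key `LiebWuPhysicaA2003`); PRL 20 (1968) 1445, eqs. (13), (18)–(19),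
  statement (c) (key `LiebWuPRL1968`).
-/

noncomputable section

open MeasureTheory Set Real Filter intervalIntegral
open Literature.Analysis.SpecialFunctions Literature.Analysis.FunctionSpaces
open scoped Convolution

namespace Literature.MathematicalPhysics.QuantumLattice

namespace LiebWuSource

variable {f g : ℝ → ℝ} {B : ℝ}

/-- `t ↦ f(t) g(x - t)` is integrable for `f ∈ L¹`, `g` bounded continuous. [folklore] -/
private theorem integrable_mul_sub (hf : Integrable f) (hgc : Continuous g) (hgB : ∀ y, |g y| ≤ B)
    (x : ℝ) : Integrable fun t => f t * g (x - t) :=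
  hf.mul_bdd (hgc.comp (continuous_const.sub continuous_id)).aestronglyMeasurable
    (Eventually.of_forall fun t => by rw [Real.norm_eq_abs]; exact hgB _)

/-- `x ↦ ∫ f(t) g(x - t) dt` is continuous for `f ∈ L¹`, `g` bounded continuous. [folklore] -/
private theorem continuous_conv (hf : Integrable f) (hgc : Continuous g) (hgB : ∀ y, |g y| ≤ B) :
    Continuous fun x => ∫ t, f t * g (x - t) := by
  have h : (fun x => ∫ t, f t * g (x - t)) = f ⋆[ContinuousLinearMap.mul ℝ ℝ, volume] g := by
    funext x; rw [convolution_def]; simp only [ContinuousLinearMap.mul_apply']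
  rw [h]
  refine BddAbove.continuous_convolution_right_of_integrable (L := ContinuousLinearMap.mul ℝ ℝ)
    ⟨B, ?_⟩ hf hgc
  rintro _ ⟨y, rfl⟩
  exact (Real.norm_eq_abs _).trans_le (hgB y)

/-- `∫_{sin k₂}^{sin k₁} φ = ∫_{k₁}^{k₂} -(φ(sin k) cos k) dk` for continuous `φ` (substitution `y = sin k`).
[folklore] -/
private theorem integral_sin_substitution {φ : ℝ → ℝ} (hφ : Continuous φ) (k₁ k₂ : ℝ) :
    ∫ y in Real.sin k₂..Real.sin k₁, φ y = ∫ k in k₁..k₂, -(φ (Real.sin k) * Real.cos k) := by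
  have h := intervalIntegral.integral_comp_mul_deriv (a := k₁) (b := k₂)
    (fun k _ => Real.hasDerivAt_sin k) Real.continuous_cos.continuousOn hφ
  rw [intervalIntegral.integral_symm, ← h, ← intervalIntegral.integral_neg]
  rfl

end LiebWuSource

open LiebWuSource

section Source

variable {U P R Q : ℝ} {h g : ℝ → ℝ}

/-- `K̂` has a positive kernel: `h ≤ g ⇒ h ∗ K ≤ g ∗ K`. [cite: LiebWuPhysicaA2003, §5, proof of Lemma 2] -/
theorem conv_cauchyDensity_mono (hU : 0 < U) (hhi : Integrable h) (hgi : Integrable g)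
    (hle : ∀ t, h t ≤ g t) (y : ℝ) :
    ∫ t, h t * cauchyDensity (U / 4) (y - t) ≤ ∫ t, g t * cauchyDensity (U / 4) (y - t) := by
  have hc : 0 < U / 4 := by positivity
  have hKB : ∀ z, |cauchyDensity (U / 4) z| ≤ 1 / (π * (U / 4)) := fun z => by
    rw [abs_of_pos (cauchyDensity_pos hc z)]; exact cauchyDensity_le hc z
  exact integral_mono (integrable_mul_sub hhi (continuous_cauchyDensity hc) hKB y)
    (integrable_mul_sub hgi (continuous_cauchyDensity hc) hKB y)
    fun t => mul_le_mul_of_nonneg_right (hle t) (cauchyDensity_pos hc _).le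

/-- `ρ₀(k) = 1/2π + cos k (σ₀ ∗ K)(sin k)` (eq. (13) at `Q = π`, `B = ∞`). [cite: LiebWuPRL1968, eqs. (13), (18)–(19)] -/
theorem liebWuRho0_eq_conv (hU : 0 < U) (k : ℝ) : liebWuRho0 U k = 1 / (2 * π) +
    Real.cos k * ∫ t, liebWuSigma0 U t * cauchyDensity (U / 4) (Real.sin k - t) := by
  have h : ∫ t, cauchyDensity (U / 4) (Real.sin k - t) * liebWuSigma0 U t =
      ∫ t, liebWuSigma0 U t * cauchyDensity (U / 4) (Real.sin k - t) :=
    MeasureTheory.integral_congr_ae (Eventually.of_forall fun t => mul_comm _ _)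
  rw [liebWuRho0_eq_integral_sigma0 hU k, h]

/-- `Ŵ_Q h (x) = ½ ∫_{-a}^{a} (h ∗ K)(y) r(x - y) dy`, `a = sin Q ≥ 0` (`0 ≤ Q ≤ π`).
[cite: LiebWuPhysicaA2003, §5, eq. (W)] -/
theorem liebWuW_eq_intervalIntegral (hQ0 : 0 ≤ Q) (hQπ : Q ≤ π) (U : ℝ) (h : ℝ → ℝ) (x : ℝ) :
    liebWuW U Q h x = 1 / 2 * ∫ y in -Real.sin Q..Real.sin Q,
      (∫ t, h t * cauchyDensity (U / 4) (y - t)) * sechKernel (U / 4) (x - y) := by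
  have ha : 0 ≤ Real.sin Q := Real.sin_nonneg_of_nonneg_of_le_pi hQ0 hQπ
  rw [liebWuW, intervalIntegral.integral_of_le (by linarith),
    ← MeasureTheory.integral_indicator (measurableSet_Ioc : MeasurableSet (Ioc (-Real.sin Q) (Real.sin Q)))]
  congr 1
  refine MeasureTheory.integral_congr_ae (Eventually.of_forall fun y => ?_)
  by_cases hy : y ∈ Ioc (-Real.sin Q) (Real.sin Q)
  · simp [indicator_of_mem hy]
  · simp [indicator_of_notMem hy]

/-- **The edge inequality** (Lemma 5 ⇒ the integrand of the source is positive): for `cos k ≤ 0` and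
`h ≤ σ₀`, `¼π⁻¹ r(x - sin k) + ½ (h∗K)(sin k) r(x - sin k) cos k ≥ ½ r(x - sin k) ρ₀(k) > 0`.
[cite: LiebWuPhysicaA2003, §6, Lemma 5] -/
private theorem liebWu_edge_pos (hU : 0 < U) (hhi : Integrable h)
    (hhσ : ∀ t, h t ≤ liebWuSigma0 U t) {k : ℝ} (hk : Real.cos k ≤ 0) (x : ℝ) :
    0 < 1 / (4 * π) * sechKernel (U / 4) (x - Real.sin k) +
      1 / 2 * ((∫ t, h t * cauchyDensity (U / 4) (Real.sin k - t)) *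
        sechKernel (U / 4) (x - Real.sin k) * Real.cos k) := by
  have hc : 0 < U / 4 := by positivity
  have hr := sechKernel_pos hc (x - Real.sin k)
  have hG := mul_le_mul_of_nonpos_left
    (conv_cauchyDensity_mono hU hhi (integrable_liebWuSigma0 hU) hhσ (Real.sin k)) hk
  have hρ := liebWuRho0_pos hU k
  rw [liebWuRho0_eq_conv hU k] at hρ
  have he : 1 / (4 * π) * sechKernel (U / 4) (x - Real.sin k) +
      1 / 2 * ((∫ t, h t * cauchyDensity (U / 4) (Real.sin k - t)) *
        sechKernel (U / 4) (x - Real.sin k) * Real.cos k) =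
      1 / 2 * sechKernel (U / 4) (x - Real.sin k) * (1 / (2 * π) +
        Real.cos k * ∫ t, h t * cauchyDensity (U / 4) (Real.sin k - t)) := by ring
  rw [he]
  exact mul_pos (by positivity) (by linarith)

/-- **The source of `σ_R - σ_P` is positive** (`0 < P < R ≤ π`, `0 ≤ h ≤ σ₀`, `h ∈ L¹`):
`(ξ_R - ξ_P)(x) + (Ŵ_R h - Ŵ_P h)(x) > 0` — trivially if `sin P ≤ sin R` (both parts `≥ 0`, the first
`> 0`), and by the substitution `y = sin k` on `max(P, π/2) ≤ |k| ≤ R` plus the edge inequality otherwise.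
[cite: LiebWuPhysicaA2003, §5, proofs of Lemmas 3–4] -/
theorem liebWu_source_pos (hU : 0 < U) (hP : 0 < P) (hPR : P < R) (hRπ : R ≤ π)
    (hhi : Integrable h) (hh0 : ∀ t, 0 ≤ h t) (hhσ : ∀ t, h t ≤ liebWuSigma0 U t) (x : ℝ) :
    0 < liebWuXi U R x - liebWuXi U P x + (liebWuW U R h x - liebWuW U P h x) := by
  have hc : 0 < U / 4 := by positivity
  have hπ := Real.pi_pos
  have hPπ : P ≤ π := by linarith
  have hR0 : 0 ≤ R := by linarith
  -- `ψ k = r(x - sin k)`, `φ y = (h ∗ K)(y) r(x - y)`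
  have hKB : ∀ z, |cauchyDensity (U / 4) z| ≤ 1 / (π * (U / 4)) := fun z => by
    rw [abs_of_pos (cauchyDensity_pos hc z)]; exact cauchyDensity_le hc z
  have hψc : Continuous fun k => sechKernel (U / 4) (x - Real.sin k) :=
    (continuous_sechKernel hc).comp (continuous_const.sub Real.continuous_sin)
  have hψ0 : ∀ k, 0 < sechKernel (U / 4) (x - Real.sin k) := fun k => sechKernel_pos hc _
  have hψi : ∀ a b, IntervalIntegrable (fun k => sechKernel (U / 4) (x - Real.sin k)) volume a b :=
    fun a b => hψc.intervalIntegrable _ _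
  have hGc : Continuous fun y => ∫ t, h t * cauchyDensity (U / 4) (y - t) :=
    continuous_conv hhi (continuous_cauchyDensity hc) hKB
  have hG0 : ∀ y, 0 ≤ ∫ t, h t * cauchyDensity (U / 4) (y - t) := fun y =>
    integral_nonneg fun t => mul_nonneg (hh0 t) (cauchyDensity_pos hc _).le
  have hφc : Continuous fun y => (∫ t, h t * cauchyDensity (U / 4) (y - t)) * sechKernel (U / 4) (x - y) :=
    hGc.mul ((continuous_sechKernel hc).comp (continuous_const.sub continuous_id))
  have hφ0 : ∀ y, 0 ≤ (∫ t, h t * cauchyDensity (U / 4) (y - t)) * sechKernel (U / 4) (x - y) :=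
    fun y => mul_nonneg (hG0 y) (sechKernel_pos hc _).le
  have hφi : ∀ a b, IntervalIntegrable
      (fun y => (∫ t, h t * cauchyDensity (U / 4) (y - t)) * sechKernel (U / 4) (x - y)) volume a b :=
    fun a b => hφc.intervalIntegrable _ _
  -- (i) `ξ_R - ξ_P = ¼π⁻¹ (∫_{-R}^{-P} ψ + ∫_{P}^{R} ψ)`
  have hξ : liebWuXi U R x - liebWuXi U P x = 1 / (4 * π) *
      ((∫ k in -R..-P, sechKernel (U / 4) (x - Real.sin k)) +
        ∫ k in P..R, sechKernel (U / 4) (x - Real.sin k)) := by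
    simp only [liebWuXi]
    rw [← mul_sub, intervalIntegral.integral_interval_sub_interval_comm (hψi _ _) (hψi _ _) (hψi _ _),
      intervalIntegral.integral_symm R P]
    ring
  -- (ii) `Ŵ_R h - Ŵ_P h = ½ (∫_{-a_R}^{-a_P} φ - ∫_{a_R}^{a_P} φ)`
  have hW : liebWuW U R h x - liebWuW U P h x = 1 / 2 *
      ((∫ y in -Real.sin R..-Real.sin P,
          (∫ t, h t * cauchyDensity (U / 4) (y - t)) * sechKernel (U / 4) (x - y)) -
        ∫ y in Real.sin R..Real.sin P,
          (∫ t, h t * cauchyDensity (U / 4) (y - t)) * sechKernel (U / 4) (x - y)) := by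
    rw [liebWuW_eq_intervalIntegral hR0 hRπ, liebWuW_eq_intervalIntegral hP.le hPπ, ← mul_sub,
      intervalIntegral.integral_interval_sub_interval_comm (hφi _ _) (hφi _ _) (hφi _ _)]
  have hI1 : 0 < ∫ k in -R..-P, sechKernel (U / 4) (x - Real.sin k) :=
    intervalIntegral.intervalIntegral_pos_of_pos_on (hψi _ _) (fun k _ => hψ0 k) (by linarith)
  have hI2 : 0 < ∫ k in P..R, sechKernel (U / 4) (x - Real.sin k) :=
    intervalIntegral.intervalIntegral_pos_of_pos_on (hψi _ _) (fun k _ => hψ0 k) hPR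
  rw [hξ, hW]
  rcases le_or_gt (Real.sin P) (Real.sin R) with hs | hs
  · -- `a_P ≤ a_R`: the `Ŵ`-part is nonnegative
    have h1 : 0 ≤ ∫ y in -Real.sin R..-Real.sin P,
        (∫ t, h t * cauchyDensity (U / 4) (y - t)) * sechKernel (U / 4) (x - y) :=
      intervalIntegral.integral_nonneg (by linarith) fun y _ => hφ0 y
    have h2 : ∫ y in Real.sin R..Real.sin P,
        (∫ t, h t * cauchyDensity (U / 4) (y - t)) * sechKernel (U / 4) (x - y) ≤ 0 := by
      rw [intervalIntegral.integral_symm]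
      exact neg_nonpos.2 (intervalIntegral.integral_nonneg hs fun y _ => hφ0 y)
    have h3 : 0 < 1 / (4 * π) * ((∫ k in -R..-P, sechKernel (U / 4) (x - Real.sin k)) +
        ∫ k in P..R, sechKernel (U / 4) (x - Real.sin k)) := mul_pos (by positivity) (by linarith)
    nlinarith
  · -- `a_R < a_P`: then `R > π/2`; substitution on `k₀ = max(P, π/2) ≤ |k| ≤ R`
    have hRgt : π / 2 < R := not_le.mp fun hle => by
      have := Real.sin_le_sin_of_le_of_le_pi_div_two (by linarith) hle hPR.le
      linarith
    obtain ⟨k₀, hk₀⟩ : ∃ k₀, k₀ = max P (π / 2) := ⟨_, rfl⟩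
    have hPk : P ≤ k₀ := hk₀ ▸ le_max_left _ _
    have hk₁ : π / 2 ≤ k₀ := hk₀ ▸ le_max_right _ _
    have hkR : k₀ < R := hk₀ ▸ max_lt hPR hRgt
    have hsk : Real.sin P ≤ Real.sin k₀ := by
      rcases le_total P (π / 2) with hP2 | hP2
      · rw [hk₀, max_eq_right hP2, Real.sin_pi_div_two]; exact Real.sin_le_one P
      · rw [hk₀, max_eq_left hP2]
    have hcos : ∀ k ∈ Icc k₀ R, Real.cos k ≤ 0 := fun k hk =>
      Real.cos_nonpos_of_pi_div_two_le_of_le (hk₁.trans hk.1) (by linarith [hk.2])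
    have hcos' : ∀ k ∈ Icc (-R) (-k₀), Real.cos k ≤ 0 := fun k hk => by
      rw [← Real.cos_neg]; exact hcos (-k) ⟨by linarith [hk.2], by linarith [hk.1]⟩
    -- enlarging the `φ`-integrals and shrinking the `ψ`-integrals
    have hB1 : ∫ y in Real.sin R..Real.sin P,
        (∫ t, h t * cauchyDensity (U / 4) (y - t)) * sechKernel (U / 4) (x - y) ≤
        ∫ y in Real.sin R..Real.sin k₀,
          (∫ t, h t * cauchyDensity (U / 4) (y - t)) * sechKernel (U / 4) (x - y) :=
      intervalIntegral.integral_mono_interval le_rfl hs.le hsk (Eventually.of_forall hφ0) (hφi _ _)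
    have hB2 : ∫ y in -Real.sin P..-Real.sin R,
        (∫ t, h t * cauchyDensity (U / 4) (y - t)) * sechKernel (U / 4) (x - y) ≤
        ∫ y in -Real.sin k₀..-Real.sin R,
          (∫ t, h t * cauchyDensity (U / 4) (y - t)) * sechKernel (U / 4) (x - y) :=
      intervalIntegral.integral_mono_interval (neg_le_neg hsk) (by linarith) le_rfl
        (Eventually.of_forall hφ0) (hφi _ _)
    have hC : ∫ y in -Real.sin R..-Real.sin P,
        (∫ t, h t * cauchyDensity (U / 4) (y - t)) * sechKernel (U / 4) (x - y) =
        -∫ y in -Real.sin P..-Real.sin R,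
          (∫ t, h t * cauchyDensity (U / 4) (y - t)) * sechKernel (U / 4) (x - y) :=
      intervalIntegral.integral_symm _ _
    have hX1 : ∫ k in k₀..R, sechKernel (U / 4) (x - Real.sin k) ≤
        ∫ k in P..R, sechKernel (U / 4) (x - Real.sin k) :=
      intervalIntegral.integral_mono_interval hPk hkR.le le_rfl
        (Eventually.of_forall fun k => (hψ0 k).le) (hψi _ _)
    have hX2 : ∫ k in -R..-k₀, sechKernel (U / 4) (x - Real.sin k) ≤
        ∫ k in -R..-P, sechKernel (U / 4) (x - Real.sin k) :=
      intervalIntegral.integral_mono_interval le_rfl (by linarith) (by linarith)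
        (Eventually.of_forall fun k => (hψ0 k).le) (hψi _ _)
    -- the substitution `y = sin k`
    have hS1 := integral_sin_substitution hφc k₀ R
    have hS2 := integral_sin_substitution hφc (-R) (-k₀)
    rw [Real.sin_neg, Real.sin_neg] at hS2
    -- positivity of the combined `k`-integrands (edge inequality) on `[k₀, R]` and `[-R, -k₀]`
    have hΦc : Continuous fun k => 1 / (4 * π) * sechKernel (U / 4) (x - Real.sin k) +
        1 / 2 * ((∫ t, h t * cauchyDensity (U / 4) (Real.sin k - t)) *
          sechKernel (U / 4) (x - Real.sin k) * Real.cos k) :=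
      (continuous_const.mul hψc).add
        (continuous_const.mul ((hφc.comp Real.continuous_sin).mul Real.continuous_cos))
    have hΦi : ∀ a b, IntervalIntegrable (fun k => 1 / (4 * π) * sechKernel (U / 4) (x - Real.sin k) +
        1 / 2 * ((∫ t, h t * cauchyDensity (U / 4) (Real.sin k - t)) *
          sechKernel (U / 4) (x - Real.sin k) * Real.cos k)) volume a b :=
      fun a b => hΦc.intervalIntegrable _ _
    have hP1 : 0 < ∫ k in k₀..R, (1 / (4 * π) * sechKernel (U / 4) (x - Real.sin k) +
        1 / 2 * ((∫ t, h t * cauchyDensity (U / 4) (Real.sin k - t)) *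
          sechKernel (U / 4) (x - Real.sin k) * Real.cos k)) :=
      intervalIntegral.intervalIntegral_pos_of_pos_on (hΦi _ _)
        (fun k hk => liebWu_edge_pos hU hhi hhσ (hcos k ⟨hk.1.le, hk.2.le⟩) x) hkR
    have hP2 : 0 < ∫ k in -R..-k₀, (1 / (4 * π) * sechKernel (U / 4) (x - Real.sin k) +
        1 / 2 * ((∫ t, h t * cauchyDensity (U / 4) (Real.sin k - t)) *
          sechKernel (U / 4) (x - Real.sin k) * Real.cos k)) :=
      intervalIntegral.intervalIntegral_pos_of_pos_on (hΦi _ _)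
        (fun k hk => liebWu_edge_pos hU hhi hhσ (hcos' k ⟨hk.1.le, hk.2.le⟩) x) (by linarith)
    have hφsi : ∀ a b, IntervalIntegrable (fun k => (∫ t, h t * cauchyDensity (U / 4) (Real.sin k - t)) *
        sechKernel (U / 4) (x - Real.sin k) * Real.cos k) volume a b :=
      fun a b => ((hφc.comp Real.continuous_sin).mul Real.continuous_cos).intervalIntegrable _ _
    have hE : ∀ a b, ∫ k in a..b, (1 / (4 * π) * sechKernel (U / 4) (x - Real.sin k) +
        1 / 2 * ((∫ t, h t * cauchyDensity (U / 4) (Real.sin k - t)) *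
          sechKernel (U / 4) (x - Real.sin k) * Real.cos k)) =
        1 / (4 * π) * (∫ k in a..b, sechKernel (U / 4) (x - Real.sin k)) -
          1 / 2 * ∫ k in a..b, -((∫ t, h t * cauchyDensity (U / 4) (Real.sin k - t)) *
            sechKernel (U / 4) (x - Real.sin k) * Real.cos k) := by
      intro a b
      rw [intervalIntegral.integral_add ((hψi a b).const_mul _) ((hφsi a b).const_mul _),
        intervalIntegral.integral_const_mul, intervalIntegral.integral_const_mul,
        intervalIntegral.integral_neg]
      ring
    rw [hE] at hP1 hP2
    rw [← hS1] at hP1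
    rw [← hS2] at hP2
    have h4 : 0 < 1 / (4 * π) := by positivity
    have hX1' := mul_le_mul_of_nonneg_left hX1 h4.le
    have hX2' := mul_le_mul_of_nonneg_left hX2 h4.le
    rw [hC]
    nlinarith

/-- **Positivity from the fixed-point inequality:** if `δ` is continuous and integrable and
`δ - Ŵ_Q δ ≥ 0`, then `δ ≥ 0` (`δ⁻ ≤ Ŵ_Q δ⁻` because `Ŵ_Q` has a positive kernel, and
`∫ Ŵ_Q δ⁻ ≤ ½ ∫ δ⁻` forces `δ⁻ = 0`). [cite: LiebWuPhysicaA2003, §5, proof of Theorem 1] -/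
theorem nonneg_of_sub_liebWuW_nonneg (hU : 0 < U) (Q : ℝ) {δ : ℝ → ℝ} (hδc : Continuous δ)
    (hδi : Integrable δ) (hs : ∀ x, 0 ≤ δ x - liebWuW U Q δ x) (x : ℝ) : 0 ≤ δ x := by
  have hpi : Integrable fun t => max (δ t) 0 := hδi.pos_part
  have hmi : Integrable fun t => max (-δ t) 0 := hδi.neg_part
  have hp0 : ∀ t, 0 ≤ max (δ t) 0 := fun t => le_max_right _ _
  have hm0 : ∀ t, 0 ≤ max (-δ t) 0 := fun t => le_max_right _ _
  have hmc : Continuous fun t => max (-δ t) 0 := hδc.neg.max continuous_const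
  obtain ⟨-, hWp0, -, -, -⟩ := liebWuW_props (Q := Q) hU hpi hp0
  obtain ⟨-, hWm0, hWmi, hWmint, -⟩ := liebWuW_props (Q := Q) hU hmi hm0
  have hδpm : (fun t => max (δ t) 0 - max (-δ t) 0) = δ :=
    funext fun t => max_zero_sub_max_neg_zero_eq_self (δ t)
  have hsplit : ∀ y, liebWuW U Q δ y =
      liebWuW U Q (fun t => max (δ t) 0) y - liebWuW U Q (fun t => max (-δ t) 0) y := by
    intro y
    rw [liebWuW_sub hU Q hpi hmi, hδpm]
  have hle : ∀ y, max (-δ y) 0 ≤ liebWuW U Q (fun t => max (-δ t) 0) y := fun y =>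
    max_le (by linarith [hs y, hsplit y, hWp0 y]) (hWm0 y)
  have hI : ∫ t, max (-δ t) 0 = 0 := by
    have h1 := integral_mono hmi hWmi hle
    have h2 : 0 ≤ ∫ t, max (-δ t) 0 := integral_nonneg hm0
    linarith
  have hae : (fun t => max (-δ t) 0) =ᵐ[volume] (fun _ => (0 : ℝ)) :=
    (integral_eq_zero_iff_of_nonneg (fun t => hm0 t) hmi).1 hI
  have hzero := congr_fun ((hmc.ae_eq_iff_eq volume continuous_const).1 hae) x
  have hx : max (-δ x) 0 = 0 := hzero
  linarith [le_max_left (-δ x) 0]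

end Source

end Literature.MathematicalPhysics.QuantumLattice

end
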